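import Mathlib.LinearAlgebra.Matrix.Charpoly.Disc                    -- Mathlib `Matrix.discr A := A.charpoly.discr`, `Matrix.discr_conj`
import Mathlib.LinearAlgebra.Matrix.Charpoly.Univ                    -- the universal characteristic polynomial
import Mathlib.RingTheory.Polynomial.Resultant.Basic                 -- `Polynomial.discr`, `resultant_deriv`, `isUnit_resultant_iff_isCoprime`
import Literature.NumberTheory.Rogawski1990.LocalTransfer             -- ★ `IsRegularElt g := (charpoly g).Separable`
import Literature.NumberTheory.Automorphic.UnitaryGroupArchimedean    -- ★ `UnitaryGroup.arch F E c N J ≤ GL_N(E ⊗ ℝ)`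
import Mathlib.NumberTheory.NumberField.CanonicalEmbedding.Basic
import Mathlib.Topology.Algebra.MvPolynomial
import HarnessLib

/-!
# The archimedean Weyl discriminant `|D(γ)|_∞` on `GL_N(E ⊗ ℝ)` and on `U(J)(E ⊗ ℝ)`: explicit, continuous, non-zero exactly on the regular elements;
# the regular locus is open (Rogawski 1990, §3.1 p. 19, §14.2 p. 232; Harish-Chandra's `D(γ)`)

Topic `NumberTheory/Automorphic`; namespaces `Literature.LinearAlgebra.Matrix` (§1, generic matrices), `Literature.NumberTheory.Automorphic` (§§2–3) and
`Literature.NumberTheory.Automorphic.UnitaryGroup` (§4).  ONE honest definition (`archWeylDiscr`, with body and `_def` lemma) + theorems; no named fact, no instance,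
no notation, no `sorry`.  Cell `hodgecm-mathlib`, floor-1 prep under letter #88 (ST-∞) ∕ SIZING-S1′ road letter «D1′a» (CENSUS-88-arch v2 §5: «`D_G(γ)`-normalised
orbital integrals on ★ `UnitaryGroup.arch` as functions of `γ ∈ T_reg`» — THIS file is the discriminant half: the function `|D(γ)|`, its zero set and the topology
of the regular locus; the orbital-integral half (Harish-Chandra's bound `|D|^{1/2} Φ_γ(f) = O(1)` on `T_reg`) is print for the non-compact factors).

THE FUNCTION.  For `γ ∈ M_N(E ⊗ ℝ)`, `E ⊗ ℝ = ℝ^{r₁} × ℂ^{r₂}` (Mathlib `mixedSpace E`), put **`archWeylDiscr γ := ∏_{w ∣ ∞} |disc χ_{γ_w}|_w`** — the product over the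
infinite places `w` of `E` of the place-absolute value (Mathlib `normAtPlace w`, NOT squared at complex places) of the discriminant of the characteristic polynomial
(Mathlib `Matrix.discr γ = (charpoly γ).discr ∈ E ⊗ ℝ`).  For `γ` in a unitary group `U(J)(E ⊗ ℝ)` one has `|det γ_w|_w = 1`, so this IS `|D_G(γ)|_∞ = ∏_w |∏_{i≠j}
(1 − λ_i λ_j^{-1})|_w = ∏_w |disc χ_{γ_w}|_w ∕ |det γ_w|_w^{N−1}`, Harish-Chandra's Weyl discriminant of `GL_N` restricted to the unitary group ([Rogawski1990] §3.1
p. 19: regular ⇔ distinct eigenvalues; §8.1 p. 116 and §14.2 p. 232: `D(γ)` in the germ ∕ limit formulas).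

WHAT IS PROVED.
* §1 (any commutative ring `R`; private Mathlib-only copies of five lemmas of ★ `CharpolyDiscTwinBridge`, a lit-balaban module not built on this cell's farm)
  `matrix_discr_eq_eval_univ` — `Matrix.discr A` is the evaluation at the entries of the discriminant of Mathlib's universal
  characteristic polynomial; **`continuous_matrix_discr`**.
* §2 (`mixedSpace E`) `isUnit_mixedSpace_iff` — a unit of `E ⊗ ℝ` is an element with every place-absolute value non-zero; `continuous_matrix_discr_mixedSpace`.
* §3 **`archWeylDiscr`** (def + `_def` + `_nonneg` + `_conj`), **`archWeylDiscr_ne_zero_iff : archWeylDiscr ↑γ ≠ 0 ↔ IsRegularElt γ`** (★ `isUnit_matrix_discr_iff` over the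
  ring `E ⊗ ℝ`), `archWeylDiscr_eq_zero_iff`, **`continuous_archWeylDiscr`**, **`isOpen_setOf_isRegularElt_mixedSpaceGL`** — the regular locus of `GL_N(E ⊗ ℝ)` is OPEN.
* §4 (`U(J)(E ⊗ ℝ) = UnitaryGroup.arch`) `UnitaryGroup.continuous_archWeylDiscr_arch`, `UnitaryGroup.archWeylDiscr_arch_ne_zero_iff`,
  **`UnitaryGroup.isOpen_setOf_isRegularElt_arch`** — what every «`γ → γ₀` through regular `γ`» limit of the singular transfer statements ((ST-∞), (κ-arch), D-G4)
  quantifies over.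

JUNK AUDIT.  `archWeylDiscr` is defined on ALL matrices (no unitarity used); for non-unitary `γ` it differs from `|D_{GL}(γ)|` by the factor `∏_w |det γ_w|_w^{N−1}`
(harmless: same zero set on `GL`, documented above).  At `N ≤ 1` `Matrix.discr = 1` and every element is regular (consistent: `archWeylDiscr = 1`).  For a
number field with no infinite place the product is empty (`= 1`) — impossible (`InfinitePlace E` is nonempty), not guarded.

HONEST LABEL: HC_CM is proved only modulo the printed citations until rung 0 closes; this file is generic linear algebra ∕ topology (count-neutral floor-1
preparation for #88's archimedean singular transfer); it pays nothing by itself.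

## References
* J. D. Rogawski, *Automorphic Representations of Unitary Groups in Three Variables*, Ann. of Math. Stud. 123 (1990), §3.1 p. 19, §8.1 p. 116, §14.2 p. 232 [Rogawski1990].
* Harish-Chandra, *A formula for semisimple Lie groups*, Amer. J. Math. 79 (1957) 733–760 (the discriminant `D(γ)` and `|D|^{1/2} Φ_f`) [HarishChandra1957].
* S. Basu, R. Pollack, M.-F. Roy, *Algorithms in Real Algebraic Geometry*, 2nd ed. (2006), Ch. 4 §4.1–4.3 (discriminant of the characteristic polynomial as a
  polynomial in the entries) [BasuPollackRoy2006].
-/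

set_option autoImplicit false

noncomputable section

open Polynomial NumberField NumberField.InfinitePlace NumberField.mixedEmbedding
open scoped Matrix MatrixGroups

/-! ## §1 `Matrix.discr` is a polynomial in the entries, hence continuous (any topological commutative ring) -/

namespace Literature.LinearAlgebra.Matrix

variable {R S : Type*} [CommRing R] [CommRing S] {n : Type*} [Fintype n] [DecidableEq n]

-- §1a: private copies of four lemmas of ★ `Literature.LinearAlgebra.Matrix.CharpolyDiscTwinBridge` (lit-balaban; that module is not built on this cell's farm
-- snapshot, so it cannot be imported here) — adapted verbatim, Mathlib-only proofs.

/-- `Res_{N,N−1}(f, f′) = (−1)^{N(N−1)/2} · discr f` for monic `f` (Mathlib `resultant_deriv`, `lc f = 1`; `N = 0` by hand).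
[cite: BasuPollackRoy2006, Ch. 4 (4.3) and Prop. 4.27, §4.2.2 pp. 110–113] -/
private theorem resultant_derivative_eq_neg_one_pow_mul_discr' {f : R[X]} (hf : f.Monic) :
    resultant f (derivative f) f.natDegree (f.natDegree - 1) = (-1) ^ (f.natDegree * (f.natDegree - 1) / 2) * f.discr := by
  by_cases h0 : f.natDegree = 0
  · have h1 : f = 1 := eq_one_of_monic_natDegree_zero hf h0
    subst h1
    have hd : discr (1 : R[X]) = 1 := by simpa using discr_C (1 : R)
    simp [hd]
  · rw [resultant_deriv (natDegree_pos_iff_degree_pos.mp (Nat.pos_of_ne_zero h0)), hf.leadingCoeff, mul_one]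

/-- The same with Mathlib's default Sylvester sizes. [cite: BasuPollackRoy2006, Ch. 4 (4.3) and Prop. 4.27, §4.2.2 pp. 110–113] -/
private theorem resultant_derivative_eq_of_monic' {f : R[X]} (hf : f.Monic) :
    resultant f (derivative f) = (-1) ^ (f.natDegree * (f.natDegree - 1) / 2) * f.discr := by
  rw [← resultant_derivative_eq_neg_one_pow_mul_discr' hf]
  obtain ⟨k, hk⟩ : ∃ k, f.natDegree - 1 = (derivative f).natDegree + k :=
    ⟨f.natDegree - 1 - (derivative f).natDegree, by have := natDegree_derivative_le f; omega⟩
  rw [hk, resultant_add_right_deg _ _ _ _ _ le_rfl]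
  by_cases h0 : f.natDegree = 0
  · have h1 : f = 1 := eq_one_of_monic_natDegree_zero hf h0
    subst h1; simp
  · rw [coeff_natDegree, hf.leadingCoeff, one_pow, one_mul]

/-- `IsUnit (discr f) ↔ f` separable, for monic `f` over a commutative ring. [cite: BasuPollackRoy2006, Ch. 4 §4.1 Prop. 4.3, pp. 101–105] -/
private theorem isUnit_discr_iff_separable_of_monic' {f : R[X]} (hf : f.Monic) : IsUnit f.discr ↔ f.Separable := by
  rw [separable_def, ← isUnit_resultant_iff_isCoprime hf, resultant_derivative_eq_of_monic' hf, IsUnit.mul_iff]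
  have hu : IsUnit ((-1 : R) ^ (f.natDegree * (f.natDegree - 1) / 2)) := (isUnit_one.neg).pow _
  simp [hu]

/-- `discr (f.map φ) = φ (discr f)` for monic `f`. [cite: BasuPollackRoy2006, Ch. 4 Prop. 4.27, §4.2.2 pp. 110–113] -/
private theorem discr_map_of_monic' (φ : R →+* S) {f : R[X]} (hf : f.Monic) : (f.map φ).discr = φ f.discr := by
  nontriviality S
  have hN : (f.map φ).natDegree = f.natDegree := hf.natDegree_map φ
  have h1 := resultant_derivative_eq_neg_one_pow_mul_discr' (hf.map φ)
  rw [hN, derivative_map, resultant_map_map, resultant_derivative_eq_neg_one_pow_mul_discr' hf, map_mul, map_pow,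
    map_neg, map_one] at h1
  have hu : IsUnit ((-1 : S) ^ (f.natDegree * (f.natDegree - 1) / 2)) := (isUnit_one.neg).pow _
  exact (hu.mul_right_inj.mp h1).symm

/-- `IsUnit (Matrix.discr A) ↔ χ_A` separable, any commutative ring — PRIVATE copy of ★ `CharpolyDiscTwinBridge.isUnit_matrix_discr_iff` (landed, but its module
does not build on this cell's farm snapshot, so it is neither importable here nor restated publicly). [cite: BasuPollackRoy2006, Ch. 4 §4.1 Prop. 4.3, pp. 101–105] -/
private theorem isUnit_matrix_discr_iff_separable (A : Matrix n n R) : IsUnit (Matrix.discr A) ↔ A.charpoly.Separable :=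
  isUnit_discr_iff_separable_of_monic' (Matrix.charpoly_monic A)

/-- `Matrix.discr A` is the evaluation at the entries of `A` of the discriminant of Mathlib's universal characteristic polynomial `Matrix.charpoly.univ R n`
(`univ_map_eval₂Hom` + ★ `discr_map_of_monic`). [cite: BasuPollackRoy2006, Ch. 4 §4.3.1 pp. 119–127] -/
theorem matrix_discr_eq_eval_univ (A : Matrix n n R) :
    Matrix.discr A = MvPolynomial.eval (fun p : n × n => A p.1 p.2) (Matrix.charpoly.univ R n).discr := by
  have h := Matrix.charpoly.univ_map_eval₂Hom n (RingHom.id R) (fun p : n × n => A p.1 p.2)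
  have hA : Matrix.of (Function.curry fun p : n × n => A p.1 p.2) = A := by
    ext i j
    rfl
  rw [hA] at h
  rw [Matrix.discr, ← h, discr_map_of_monic' _ (Matrix.charpoly.univ_monic R n)]
  rfl

/-- **`A ↦ Matrix.discr A` is continuous** on `M_n(R)` for every topological commutative ring `R` (a polynomial in the entries).
[cite: BasuPollackRoy2006, Ch. 4 §4.3.1 pp. 119–127] -/
theorem continuous_matrix_discr [TopologicalSpace R] [IsTopologicalRing R] : Continuous fun A : Matrix n n R => Matrix.discr A := by
  have h : (fun A : Matrix n n R => Matrix.discr A) =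
      fun A => MvPolynomial.eval (fun p : n × n => A p.1 p.2) (Matrix.charpoly.univ R n).discr :=
    funext matrix_discr_eq_eval_univ
  rw [h]
  exact (MvPolynomial.continuous_eval _).comp
    (continuous_pi fun p : n × n => (continuous_apply p.2).comp ((continuous_apply p.1).comp continuous_id))

end Literature.LinearAlgebra.Matrix

namespace Literature.NumberTheory.Automorphic

open Literature.LinearAlgebra.Matrix Literature.NumberTheory.Rogawski1990

variable {E : Type*} [Field E] [NumberField E] {N : ℕ}

/-! ## §2 Units and place-absolute values in `E ⊗ ℝ` -/

omit [NumberField E] in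
/-- A unit of `E ⊗ ℝ = ℝ^{r₁} × ℂ^{r₂}` is exactly an element all of whose place-absolute values are non-zero. [cite: Rogawski1990, §3.1 p. 19] -/
theorem isUnit_mixedSpace_iff (x : mixedSpace E) : IsUnit x ↔ ∀ w : InfinitePlace E, normAtPlace w x ≠ 0 := by
  rw [Prod.isUnit_iff, Pi.isUnit_iff, Pi.isUnit_iff]
  constructor
  · rintro ⟨h₁, h₂⟩ w
    by_cases hw : IsReal w
    · rw [normAtPlace_apply_of_isReal hw, norm_ne_zero_iff]
      exact (h₁ ⟨w, hw⟩).ne_zero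
    · rw [normAtPlace_apply_of_isComplex (not_isReal_iff_isComplex.mp hw), norm_ne_zero_iff]
      exact (h₂ ⟨w, not_isReal_iff_isComplex.mp hw⟩).ne_zero
  · intro h
    refine ⟨fun v => ?_, fun v => ?_⟩
    · have hv := h v.1
      rw [normAtPlace_apply_of_isReal v.2, norm_ne_zero_iff] at hv
      exact isUnit_iff_ne_zero.mpr hv
    · have hv := h v.1
      rw [normAtPlace_apply_of_isComplex v.2, norm_ne_zero_iff] at hv
      exact isUnit_iff_ne_zero.mpr hv

omit [NumberField E] in
/-- `γ ↦ disc χ_γ ∈ E ⊗ ℝ` is continuous on `M_N(E ⊗ ℝ)` (§1 over the topological ring `E ⊗ ℝ`). [cite: BasuPollackRoy2006, Ch. 4 §4.3.1 pp. 119–127] -/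
theorem continuous_matrix_discr_mixedSpace : Continuous fun A : Matrix (Fin N) (Fin N) (mixedSpace E) => Matrix.discr A :=
  continuous_matrix_discr

/-! ## §3 The archimedean Weyl discriminant -/

/-- **The archimedean Weyl discriminant** `|D(γ)|_∞ := ∏_{w ∣ ∞} |disc χ_{γ_w}|_w` of `γ ∈ M_N(E ⊗ ℝ)` (place-absolute values `normAtPlace w`, not squared at complex
places; for unitary `γ` this is Harish-Chandra's `|D_G(γ)| = ∏_w |∏_{i ≠ j}(1 − λ_i∕λ_j)|_w` since `|det γ_w|_w = 1`). [cite: Rogawski1990, §8.1 p. 116; §14.2 p. 232]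
[cite: HarishChandra1957, §1] -/
def archWeylDiscr (γ : Matrix (Fin N) (Fin N) (mixedSpace E)) : ℝ :=
  ∏ w : InfinitePlace E, normAtPlace w (Matrix.discr γ)

/-- Unfolding of `archWeylDiscr`. [cite: Rogawski1990, §14.2 p. 232] -/
theorem archWeylDiscr_def (γ : Matrix (Fin N) (Fin N) (mixedSpace E)) :
    archWeylDiscr γ = ∏ w : InfinitePlace E, normAtPlace w (Matrix.discr γ) :=
  rfl

/-- `|D(γ)|_∞ ≥ 0`. [cite: Rogawski1990, §14.2 p. 232] -/
theorem archWeylDiscr_nonneg (γ : Matrix (Fin N) (Fin N) (mixedSpace E)) : 0 ≤ archWeylDiscr γ :=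
  Finset.prod_nonneg fun w _ => normAtPlace_nonneg w _

/-- `|D|_∞` is a class function: `|D(g γ g⁻¹)|_∞ = |D(γ)|_∞` (Mathlib `Matrix.discr_conj`). [cite: Rogawski1990, §3.1 p. 19] -/
theorem archWeylDiscr_conj (g : GL (Fin N) (mixedSpace E)) (γ : Matrix (Fin N) (Fin N) (mixedSpace E)) :
    archWeylDiscr (g.val * γ * g.val⁻¹) = archWeylDiscr γ := by
  rw [archWeylDiscr, archWeylDiscr, Matrix.discr_conj]

/-- **`|D(γ)|_∞ ≠ 0 ↔ γ` is regular** (`IsRegularElt γ`: `χ_γ` separable over the ring `E ⊗ ℝ` ⇔ `disc χ_γ` a unit of `E ⊗ ℝ` (★ `isUnit_matrix_discr_iff`) ⇔ every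
place-absolute value of `disc χ_γ` is non-zero). [cite: Rogawski1990, §3.1 p. 19; §14.2 p. 232] -/
theorem archWeylDiscr_ne_zero_iff (γ : GL (Fin N) (mixedSpace E)) :
    archWeylDiscr (γ : Matrix (Fin N) (Fin N) (mixedSpace E)) ≠ 0 ↔ IsRegularElt γ := by
  rw [IsRegularElt, ← isUnit_matrix_discr_iff_separable, isUnit_mixedSpace_iff, archWeylDiscr, Finset.prod_ne_zero_iff]
  exact ⟨fun h w => h w (Finset.mem_univ w), fun h w _ => h w⟩

/-- `|D(γ)|_∞ = 0 ↔ γ` is NOT regular. [cite: Rogawski1990, §3.1 p. 19] -/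
theorem archWeylDiscr_eq_zero_iff (γ : GL (Fin N) (mixedSpace E)) :
    archWeylDiscr (γ : Matrix (Fin N) (Fin N) (mixedSpace E)) = 0 ↔ ¬ IsRegularElt γ := by
  rw [← archWeylDiscr_ne_zero_iff, not_not]

/-- **`γ ↦ |D(γ)|_∞` is continuous** on `M_N(E ⊗ ℝ)`. [cite: Rogawski1990, §14.2 p. 232] [cite: BasuPollackRoy2006, Ch. 4 §4.3.1 pp. 119–127] -/
theorem continuous_archWeylDiscr : Continuous fun γ : Matrix (Fin N) (Fin N) (mixedSpace E) => archWeylDiscr γ :=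
  continuous_finsetProd _ fun w _ => (continuous_normAtPlace w).comp continuous_matrix_discr_mixedSpace

/-- `g ↦ |D(g)|_∞` is continuous on `GL_N(E ⊗ ℝ)`. [cite: Rogawski1990, §14.2 p. 232] -/
theorem continuous_archWeylDiscr_units :
    Continuous fun γ : GL (Fin N) (mixedSpace E) => archWeylDiscr (γ : Matrix (Fin N) (Fin N) (mixedSpace E)) :=
  continuous_archWeylDiscr.comp Units.continuous_val

/-- **THE REGULAR LOCUS OF `GL_N(E ⊗ ℝ)` IS OPEN** (`= {|D|_∞ ≠ 0}`). [cite: Rogawski1990, §3.1 p. 19; §14.2 p. 232] -/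
theorem isOpen_setOf_isRegularElt_mixedSpaceGL : IsOpen {γ : GL (Fin N) (mixedSpace E) | IsRegularElt γ} := by
  have h : {γ : GL (Fin N) (mixedSpace E) | IsRegularElt γ} =
      (fun γ : GL (Fin N) (mixedSpace E) => archWeylDiscr (γ : Matrix (Fin N) (Fin N) (mixedSpace E))) ⁻¹' {0}ᶜ := by
    ext γ
    simp only [Set.mem_setOf_eq, Set.mem_preimage, Set.mem_compl_iff, Set.mem_singleton_iff, ← archWeylDiscr_ne_zero_iff, ne_eq]
  rw [h]
  exact isOpen_compl_singleton.preimage continuous_archWeylDiscr_units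

/-- The NON-regular elements of `GL_N(E ⊗ ℝ)` form a closed set (`= {|D|_∞ = 0}`). [cite: Rogawski1990, §3.1 p. 19] -/
theorem isClosed_setOf_not_isRegularElt_mixedSpaceGL : IsClosed {γ : GL (Fin N) (mixedSpace E) | ¬ IsRegularElt γ} := by
  rw [← isOpen_compl_iff]
  convert isOpen_setOf_isRegularElt_mixedSpaceGL (E := E) (N := N) using 1
  ext γ
  simp only [Set.mem_compl_iff, Set.mem_setOf_eq, not_not]

/-! ## §4 On the unitary group `U(J)(E ⊗ ℝ) = UnitaryGroup.arch` -/

namespace UnitaryGroup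

variable (F : Type) {E' : Type} [Field F] [Field E'] [NumberField E'] [Algebra F E'] (c : E' ≃ₐ[F] E') (J : Matrix (Fin N) (Fin N) E')

/-- `γ ↦ |D(γ)|_∞` is continuous on `U(J)(E ⊗ ℝ)`. [cite: Rogawski1990, §14.2 p. 232] -/
theorem continuous_archWeylDiscr_arch :
    Continuous fun γ : arch F E' c N J => archWeylDiscr ((γ : GL (Fin N) (mixedSpace E')) : Matrix (Fin N) (Fin N) (mixedSpace E')) :=
  continuous_archWeylDiscr_units.comp continuous_subtype_val

/-- On `U(J)(E ⊗ ℝ)`: `|D(γ)|_∞ ≠ 0 ↔ γ` regular. [cite: Rogawski1990, §3.1 p. 19; §14.2 p. 232] -/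
theorem archWeylDiscr_arch_ne_zero_iff (γ : arch F E' c N J) :
    archWeylDiscr ((γ : GL (Fin N) (mixedSpace E')) : Matrix (Fin N) (Fin N) (mixedSpace E')) ≠ 0 ↔
      IsRegularElt (γ : GL (Fin N) (mixedSpace E')) :=
  archWeylDiscr_ne_zero_iff _

/-- **THE REGULAR LOCUS OF `U(J)(E ⊗ ℝ)` IS OPEN** — the set the «`γ → γ₀` through regular `γ`» limits of the singular transfer statements range over.
[cite: Rogawski1990, §14.2 p. 232; §14.5 p. 239] -/
theorem isOpen_setOf_isRegularElt_arch : IsOpen {γ : arch F E' c N J | IsRegularElt (γ : GL (Fin N) (mixedSpace E'))} :=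
  isOpen_setOf_isRegularElt_mixedSpaceGL.preimage continuous_subtype_val

/-- The non-regular elements of `U(J)(E ⊗ ℝ)` form a closed set. [cite: Rogawski1990, §14.2 p. 232] -/
theorem isClosed_setOf_not_isRegularElt_arch : IsClosed {γ : arch F E' c N J | ¬ IsRegularElt (γ : GL (Fin N) (mixedSpace E'))} :=
  isClosed_setOf_not_isRegularElt_mixedSpaceGL.preimage continuous_subtype_val

end UnitaryGroup

end Literature.NumberTheory.Automorphic

end


/-! ## §5 (ED. 2, «D1′a» B1′) The discriminant of a split product of linear factors and of a DIAGONAL matrix; `|D(diag d)|_∞` explicitly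

`discr (∏_i (X − a_i)) = (−1)^{n(n−1)/2} ∏_i ∏_{j ≠ i} (a_i − a_j)` over EVERY commutative ring (the universal identity, proved over the domain `ℤ[X_i]` through
Mathlib's `resultant_eq_prod_eval` — `Res(f, f′) = ∏_{f(α)=0} f′(α)` — and `eval_multiset_prod_X_sub_C_derivative` — `f′(a_i) = ∏_{j≠i}(a_i − a_j)` — then
specialised along `MvPolynomial.aeval a`), hence `Matrix.discr (diagonal d)` (Mathlib `charpoly_diagonal`) and, the place-absolute values killing the sign,
`|D(diag d)|_∞ = ∏_w ∏_i ∏_{j≠i} |d_i − d_j|_w` — the torus-coordinate form road letter «D1′b» (F0P3a-p06) consumes. -/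

noncomputable section

namespace Literature.LinearAlgebra.Matrix

open Polynomial

variable {R : Type*} [CommRing R]

/-- Domain case, multiset form: `discr (∏_{a ∈ s} (X − a)) = (−1)^{|s|(|s|−1)/2} ∏_{r ∈ s} ∏_{a ∈ s ∖ {r}} (r − a)` (one copy of `r` erased).
[cite: BasuPollackRoy2006, Ch. 4 §4.1 (4.1) and Prop. 4.3, pp. 101–105] -/
private theorem discr_multiset_prod_X_sub_C_of_isDomain {D : Type*} [CommRing D] [IsDomain D] [DecidableEq D] (s : Multiset D) :
    (s.map fun a => X - C a).prod.discr =
      (-1) ^ (Multiset.card s * (Multiset.card s - 1) / 2) * (s.map fun r => ((s.erase r).map fun a => r - a).prod).prod := by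
  -- the monic split polynomial `f = ∏ (X − a)` with roots `s`
  have hmon : (s.map fun a => X - C a).prod.Monic := monic_multiset_prod_of_monic _ _ fun a _ => monic_X_sub_C a
  have hdeg : (s.map fun a => X - C a).prod.natDegree = Multiset.card s := natDegree_multiset_prod_X_sub_C_eq_card s
  have hspl : (s.map fun a => X - C a).prod.Splits :=
    Splits.multisetProd fun g hg => by
      obtain ⟨a, -, rfl⟩ := Multiset.mem_map.mp hg
      exact Splits.X_sub_C a
  have hroots : (s.map fun a => X - C a).prod.roots = s := roots_multiset_prod_X_sub_C s
  -- `Res(f, f′) = (−1)^e · discr f` and `Res(f, f′) = ∏_{r ∈ s} f′(r)`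
  have h1 := resultant_derivative_eq_neg_one_pow_mul_discr' hmon
  have h2 := resultant_eq_prod_eval (s.map fun a => X - C a).prod (derivative (s.map fun a => X - C a).prod)
    ((s.map fun a => X - C a).prod.natDegree - 1) (natDegree_derivative_le _) hspl
  rw [hmon.leadingCoeff, one_pow, one_mul, hroots] at h2
  -- `f′(r) = ∏_{a ∈ s ∖ r} (r − a)` at every `r ∈ s`
  have h3 : (s.map fun r => eval r (derivative (s.map fun a => X - C a).prod)) =
      s.map fun r => ((s.erase r).map fun a => r - a).prod :=
    Multiset.map_congr rfl fun r hr => eval_multiset_prod_X_sub_C_derivative hr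
  have h4 : (-1 : D) ^ (Multiset.card s * (Multiset.card s - 1) / 2) * (s.map fun a => X - C a).prod.discr =
      (s.map fun r => ((s.erase r).map fun a => r - a).prod).prod := by
    rw [← hdeg, ← h1, h2]
    exact congrArg Multiset.prod h3
  have hu : (-1 : D) ^ (Multiset.card s * (Multiset.card s - 1) / 2) * (-1 : D) ^ (Multiset.card s * (Multiset.card s - 1) / 2) = 1 := by
    rw [← pow_add, ← two_mul, pow_mul, neg_one_sq, one_pow]
  calc (s.map fun a => X - C a).prod.discr
      = ((-1 : D) ^ (Multiset.card s * (Multiset.card s - 1) / 2) * (-1 : D) ^ (Multiset.card s * (Multiset.card s - 1) / 2)) *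
          (s.map fun a => X - C a).prod.discr := by rw [hu, one_mul]
    _ = (-1 : D) ^ (Multiset.card s * (Multiset.card s - 1) / 2) *
          ((-1 : D) ^ (Multiset.card s * (Multiset.card s - 1) / 2) * (s.map fun a => X - C a).prod.discr) := by rw [mul_assoc]
    _ = _ := by rw [h4]

/-- Domain case, indexed form. [cite: BasuPollackRoy2006, Ch. 4 §4.1 (4.1) and Prop. 4.3, pp. 101–105] -/
private theorem discr_prod_X_sub_C_of_isDomain {D : Type*} [CommRing D] [IsDomain D] {ι : Type*} [Fintype ι] [DecidableEq ι] (b : ι → D) :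
    (∏ i, (X - C (b i))).discr = (-1) ^ (Fintype.card ι * (Fintype.card ι - 1) / 2) * ∏ i, ∏ j ∈ Finset.univ.erase i, (b i - b j) := by
  classical
  have hm := discr_multiset_prod_X_sub_C_of_isDomain ((Finset.univ : Finset ι).val.map b)
  rw [Multiset.map_map, Multiset.map_map, Multiset.card_map, Finset.card_val, Finset.card_univ] at hm
  have e1 : (((Finset.univ : Finset ι).val).map ((fun a : D => X - C a) ∘ b)).prod = ∏ i, (X - C (b i)) := rfl
  have e2 : (((Finset.univ : Finset ι).val).map
      ((fun r : D => ((((Finset.univ : Finset ι).val.map b).erase r).map fun a => r - a).prod) ∘ b)).prod =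
      ∏ i, ∏ j ∈ Finset.univ.erase i, (b i - b j) := by
    change ∏ i, ((((Finset.univ : Finset ι).val.map b).erase (b i)).map fun a => b i - a).prod = _
    refine Finset.prod_congr rfl fun i _ => ?_
    rw [← Multiset.map_erase_of_mem b _ (Finset.mem_univ_val i), Multiset.map_map, ← Finset.erase_val]
    rfl
  rw [e1, e2] at hm
  exact hm

/-- **`discr (∏_i (X − a_i)) = (−1)^{n(n−1)/2} · ∏_i ∏_{j ≠ i} (a_i − a_j)` OVER EVERY COMMUTATIVE RING** (`n = |ι|`; the universal identity: domain case over `ℤ[X_i]`,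
then `MvPolynomial.aeval a` and `discr (f.map φ) = φ (discr f)` for monic `f`).  Equivalently `= ∏_{i<j} (a_i − a_j)²`.
[cite: BasuPollackRoy2006, Ch. 4 §4.1 (4.1) and Prop. 4.3, pp. 101–105] -/
theorem discr_prod_X_sub_C {ι : Type*} [Fintype ι] [DecidableEq ι] (a : ι → R) :
    (∏ i, (X - C (a i))).discr = (-1) ^ (Fintype.card ι * (Fintype.card ι - 1) / 2) * ∏ i, ∏ j ∈ Finset.univ.erase i, (a i - a j) := by
  -- universal case over the domain `ℤ[X_i]`, specialised along `aeval a`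
  have key := discr_prod_X_sub_C_of_isDomain (fun i : ι => (MvPolynomial.X i : MvPolynomial ι ℤ))
  have hmon : (∏ i, (X - C (MvPolynomial.X i : MvPolynomial ι ℤ))).Monic := monic_prod_of_monic _ _ fun i _ => monic_X_sub_C _
  have hmap : (∏ i, (X - C (MvPolynomial.X i : MvPolynomial ι ℤ))).map (MvPolynomial.aeval a : MvPolynomial ι ℤ →ₐ[ℤ] R).toRingHom =
      ∏ i, (X - C (a i)) := by
    rw [Polynomial.map_prod]
    refine Finset.prod_congr rfl fun i _ => ?_
    rw [Polynomial.map_sub, Polynomial.map_X, Polynomial.map_C, AlgHom.toRingHom_eq_coe, AlgHom.coe_toRingHom, MvPolynomial.aeval_X]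
  rw [← hmap, discr_map_of_monic' _ hmon, key, map_mul, map_pow, map_neg, map_one, map_prod]
  refine congrArg _ (Finset.prod_congr rfl fun i _ => ?_)
  rw [map_prod]
  refine Finset.prod_congr rfl fun j _ => ?_
  rw [map_sub, AlgHom.toRingHom_eq_coe, AlgHom.coe_toRingHom, MvPolynomial.aeval_X, MvPolynomial.aeval_X]

/-- **`Matrix.discr (diagonal d) = (−1)^{n(n−1)/2} · ∏_i ∏_{j ≠ i} (d_i − d_j)`** over every commutative ring (Mathlib `charpoly_diagonal` + `discr_prod_X_sub_C`).
[cite: BasuPollackRoy2006, Ch. 4 §4.3.1 pp. 119–127] [cite: Rogawski1990, §3.1 p. 19] -/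
theorem matrix_discr_diagonal {n : Type*} [Fintype n] [DecidableEq n] (d : n → R) :
    Matrix.discr (Matrix.diagonal d) = (-1) ^ (Fintype.card n * (Fintype.card n - 1) / 2) * ∏ i, ∏ j ∈ Finset.univ.erase i, (d i - d j) := by
  rw [Matrix.discr, Matrix.charpoly_diagonal, discr_prod_X_sub_C]

end Literature.LinearAlgebra.Matrix

namespace Literature.NumberTheory.Automorphic

open NumberField NumberField.InfinitePlace NumberField.mixedEmbedding Literature.LinearAlgebra.Matrix

variable {E : Type*} [Field E] [NumberField E] {N : ℕ}

omit [NumberField E] in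
/-- Place-absolute values of `disc χ_{diag d}`: `|discr (diagonal d)|_w = ∏_i ∏_{j ≠ i} |d_i − d_j|_w` (the sign `(−1)^{N(N−1)/2}` has absolute value `1`).
[cite: Rogawski1990, §3.1 p. 19; §14.2 p. 232] -/
theorem normAtPlace_matrix_discr_diagonal (w : NumberField.InfinitePlace E) (d : Fin N → mixedSpace E) :
    normAtPlace w (Matrix.discr (Matrix.diagonal d)) = ∏ i, ∏ j ∈ Finset.univ.erase i, normAtPlace w (d i - d j) := by
  rw [matrix_discr_diagonal, map_mul, map_pow, normAtPlace_neg, map_one, one_pow, one_mul, map_prod]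
  exact Finset.prod_congr rfl fun i _ => map_prod (normAtPlace w) _ _

/-- **`|D(diag d)|_∞ = ∏_w ∏_i ∏_{j ≠ i} |d_i − d_j|_w`** (`= ∏_w ∏_{i<j} |d_i − d_j|_w²`) for a diagonal `d : Fin N → E ⊗ ℝ` — the explicit Weyl discriminant on the diagonal torus
that the torus-angle coordinates of road letter «D1′b» read (`|e^{iθ_i} − e^{iθ_j}|²` per complex place). [cite: Rogawski1990, §8.1 p. 116; §14.2 p. 232] [cite: HarishChandra1957, §1] -/
theorem archWeylDiscr_diagonal (d : Fin N → mixedSpace E) :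
    archWeylDiscr (Matrix.diagonal d) = ∏ w : NumberField.InfinitePlace E, ∏ i, ∏ j ∈ Finset.univ.erase i, normAtPlace w (d i - d j) := by
  rw [archWeylDiscr_def]
  exact Finset.prod_congr rfl fun w _ => normAtPlace_matrix_discr_diagonal w d

end Literature.NumberTheory.Automorphic

end
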